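import Summits.HodgeConjecture.HodgeConjecture.Theorems.F0LD1ThetaTransportKit
import HarnessLib

/-!
# Crux `HLiu418`, lines LD1 ∕ LD2 — the theta SEAM along an abstract transport `ιA` is detected by a CHARACTER
# (abstract-`ιA` twin of ★ `Liu2021.MeetsThetaLiftFromLine.exists_charCM_starProjection_ne_zero`, the one §5 lemma of ★ `ThetaLiftFromLineCharacters`
# not in ★ `F0LD1ThetaTransportKit`)

Cell hodgecm-mathlib (D-0151), FLOOR 0; crux item `HLiu418` = stmt-HodgeConjecture-24832; half-A lines LD1 ∕ LD2.  Seat LD2-p02 (g0).  THEOREMS ONLY (no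
`def`, no instance, no notation, no named fact, no `sorry`); `--supports stmt-HodgeConjecture-24832 --as helper`.  HC_CM is proved only modulo the 7 printed
citations (2 remaining: hLiu418, h413) until rung 0 closes; this file discharges nothing printed.

`MeetsThetaLiftFromLine.exists_charCM_starProjection_ne_zero` — if the discrete `P` of `U(H)` meets the theta lift from the line `⟨a⟩` along ANY transport `ιA`
that is continuous and carries rational points to rational points (`hιA`, e.g. the pinned transport of the LD organs: ★ `F0LD2FrameTransportPin`), then
`pr_P [Θ̃_Φ(χ) ∘ ιA] ≠ 0` for some continuous unitary CHARACTER `χ` of `[U(⟨a⟩)]` (same majorant witness, measure and `Φ` as the seam's) — node B steps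
(1)–(2) of [Liu2021, proof of Prop. 4.13 Case 1]; proof = the ★ proof over ★ `F0LD1ThetaTransportKit.exists_charCM_of_apply_toLp_lineThetaLift_ne_zero`
(LD1-p01 (g0)).  Rank-generic `N`.

## References
* [Liu2021] Y. Liu, Camb. J. Math. 9 (2021) = arXiv:2102.11518, proof of Prop. 4.13 Case 1 (l. 2131–2137, p. 48).
* [GelbartRogawski1991] S. Gelbart, J. Rogawski, Invent. Math. 105 (1991), §3.2 p. 457.
* [DeitmarEchterhoff2014] A. Deitmar, S. Echterhoff, 2nd ed., Prop. 3.5.2; Thm. 7.3.2.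
-/

set_option autoImplicit false
-- the mandated namespace has the single-problem summit's repeated segment (`HodgeConjecture.HodgeConjecture`)
set_option linter.dupNamespace false

noncomputable section

open NumberField MeasureTheory IsDedekindDomain
open scoped Matrix ComplexOrder ENNReal

namespace Summit.HodgeConjecture.HodgeConjecture.Cruxes.HLiu418.F0LD2ThetaSeamCharacter

open _root_.MeasureTheory
open Literature.NumberTheory.Automorphic Literature.NumberTheory.Automorphic.UnitaryGroup
open Literature.NumberTheory.Automorphic.UnitaryGroup.CotangentForms
open Literature.NumberTheory.Automorphic.IdeleClassGroup
open Literature.NumberTheory.Automorphic.Liu2021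
open Literature.NumberTheory.Automorphic.Liu2021.Def411WeilCarriers
open Literature.NumberTheory.Automorphic.Liu2021.Def411WeilCarriersDoubling
open Literature.NumberTheory.GelbartRogawski1991 Literature.NumberTheory.GelbartRogawski1991.UnitaryDualPair
open Literature.NumberTheory.Weil1964
open Literature.RepresentationTheory.Liu2021
open Literature.RepresentationTheory.CompactGroups
open Summit.HodgeConjecture.HodgeConjecture.Cruxes.HLiu418.F0LD1ThetaTransportKit

/-! ## The seam is detected by a character (★ `ThetaLiftFromLineCharacters` §5) -/

section Seam

variable (L : Type) [Field L] [NumberField L] [IsCMField L] (N : ℕ) (H : Matrix (Fin N) (Fin N) L)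
  {n' : ℕ} (e₁ : Fin N × Fin 1 ≃ Fin n') (dV : Fin N → L) (hdV : ∀ i, IsCMField.complexConj L (dV i) = dV i)
  (hdV0 : ∀ i, dV i ≠ 0)
  (ιA : (adelicGroupData (↥(maximalRealSubfield L)) L (IsCMField.complexConj L) N H).Adelic →*
    ↥(UnitaryGroup.adelic (↥(maximalRealSubfield L)) L (IsCMField.complexConj L) N (Matrix.diagonal dV)))
  (hιA : Continuous ιA ∧ ∀ ⦃γ : (adelicGroupData (↥(maximalRealSubfield L)) L (IsCMField.complexConj L) N H).Adelic⦄,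
    γ ∈ (UnitaryGroup.toAdelic (↥(maximalRealSubfield L)) L (IsCMField.complexConj L) N H).range →
      ιA γ ∈ (UnitaryGroup.toAdelic (↥(maximalRealSubfield L)) L (IsCMField.complexConj L) N (Matrix.diagonal dV)).range)
  {μA : Measure (adelicGroupData (↥(maximalRealSubfield L)) L (IsCMField.complexConj L) N H).automorphicQuotient} [(adelicGroupData (↥(maximalRealSubfield L)) L (IsCMField.complexConj L) N H).IsAutomorphicMeasure μA] [CompactSpace (adelicGroupData (↥(maximalRealSubfield L)) L (IsCMField.complexConj L) N H).automorphicQuotient]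
  [CompactSpace (↥(UnitaryGroup.adelic (↥(maximalRealSubfield L)) L (IsCMField.complexConj L) N (Matrix.diagonal dV)) ⧸ (UnitaryGroup.toAdelic (↥(maximalRealSubfield L)) L (IsCMField.complexConj L) N (Matrix.diagonal dV)).range)]

include hιA

/-- **NODE B, STEPS (1)–(2): if `P` meets the theta lift from the line `⟨a⟩` (seam ★ `MeetsThetaLiftFromLine`, along the transport of the
(C♯)hol frame), then the orthogonal projection onto `P` of the `L²`-class of the theta lift `Θ̃_Φ(χ) ∘ ιA` of some continuous unitary
CHARACTER `χ` of `[U(⟨a⟩)]` is non-zero** (same majorant witness, measure and `Φ` as the seam's).  The printed «`σ` is a character of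
`U(W)`, `dim W = 1`» [Liu2021, l. 2135] made honest: `pr_P` does not vanish on the seam's class (it lies in `P` and is `≠ 0`), and §4.
[cite: Liu2021, proof of Prop. 4.13 Case 1 (l. 2131–2137, p. 48)] [cite: GelbartRogawski1991, §3.2 p. 457] [cite: DeitmarEchterhoff2014, Prop. 3.5.2; Thm. 7.3.2] -/
theorem MeetsThetaLiftFromLine.exists_charCM_starProjection_ne_zero
    (P : DiscreteAutomorphicRep (adelicGroupData (↥(maximalRealSubfield L)) L (IsCMField.complexConj L) N H) μA) (μ : Literature.NumberTheory.Automorphic.IdeleClassGroup L →ₜ* Circle)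
    (hμ : IsConjugateSymplectic L μ) (a : (↥(maximalRealSubfield L))ˣ)
    (h : MeetsThetaLiftFromLine L N H e₁ dV hdV hdV0 P μ hμ a ιA) :
    letI : MeasurableSpace (↥(UnitaryGroup.adelic (↥(maximalRealSubfield L)) L (IsCMField.complexConj L) 1 (JW (↥(maximalRealSubfield L)) L a)) ⧸ (UnitaryGroup.toAdelic (↥(maximalRealSubfield L)) L (IsCMField.complexConj L) 1 (JW (↥(maximalRealSubfield L)) L a)).range) := borel _
    haveI := normal_range_toAdelic_JW L a
    ∃ (hρ : HasThetaMajorants fun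
      (p : ↥(UnitaryGroup.adelic (↥(maximalRealSubfield L)) L (IsCMField.complexConj L) N (Matrix.diagonal dV)) × ↥(UnitaryGroup.adelic (↥(maximalRealSubfield L)) L (IsCMField.complexConj L) 1 (JW (↥(maximalRealSubfield L)) L a))) (Φ : piSchwartzBruhat (↥(maximalRealSubfield L)) (Fin n')) =>
        pairRep (↥(maximalRealSubfield L)) L (IsCMField.complexConj L) N 1 e₁ (Matrix.diagonal dV) (JW (↥(maximalRealSubfield L)) L a)
          (chiSplittingLine L e₁ dV hdV hdV0 (toHeckeCharacter L μ) (isUnitary_toHeckeCharacter L μ)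
            ((isOscillatorChar_toHeckeCharacter_iff μ).mpr hμ) (TW (↥(maximalRealSubfield L)) a)
            (isUnit_det_TW (↥(maximalRealSubfield L)) a) (JW (↥(maximalRealSubfield L)) L a) (JW_eq (↥(maximalRealSubfield L)) L a))
          p Φ) (μW : Measure (↥(UnitaryGroup.adelic (↥(maximalRealSubfield L)) L (IsCMField.complexConj L) 1 (JW (↥(maximalRealSubfield L)) L a)) ⧸ (UnitaryGroup.toAdelic (↥(maximalRealSubfield L)) L (IsCMField.complexConj L) 1 (JW (↥(maximalRealSubfield L)) L a)).range)) (_ : IsFiniteMeasure μW) (_ : SMulInvariantMeasure ↥(UnitaryGroup.adelic (↥(maximalRealSubfield L)) L (IsCMField.complexConj L) 1 (JW (↥(maximalRealSubfield L)) L a)) (↥(UnitaryGroup.adelic (↥(maximalRealSubfield L)) L (IsCMField.complexConj L) 1 (JW (↥(maximalRealSubfield L)) L a)) ⧸ (UnitaryGroup.toAdelic (↥(maximalRealSubfield L)) L (IsCMField.complexConj L) 1 (JW (↥(maximalRealSubfield L)) L a)).range) μW)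
      (Φ : piSchwartzBruhat (↥(maximalRealSubfield L)) (Fin n')) (χ : PontryaginDual (↥(UnitaryGroup.adelic (↥(maximalRealSubfield L)) L (IsCMField.complexConj L) 1 (JW (↥(maximalRealSubfield L)) L a)) ⧸ (UnitaryGroup.toAdelic (↥(maximalRealSubfield L)) L (IsCMField.complexConj L) 1 (JW (↥(maximalRealSubfield L)) L a)).range))
      (hθ : MemLp (toQuotFun (adelicGroupData (↥(maximalRealSubfield L)) L (IsCMField.complexConj L) N H) fun x => (lineThetaKernelDatum L N e₁ dV hdV hdV0 μ hμ a hρ).thetaLiftFun μW Φ (charCM χ) (ιA x)) 2 μA),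
      P.space.toSubmodule.starProjection (MemLp.toLp _ hθ) ≠ 0 := by
  letI : MeasurableSpace (↥(UnitaryGroup.adelic (↥(maximalRealSubfield L)) L (IsCMField.complexConj L) 1 (JW (↥(maximalRealSubfield L)) L a)) ⧸ (UnitaryGroup.toAdelic (↥(maximalRealSubfield L)) L (IsCMField.complexConj L) 1 (JW (↥(maximalRealSubfield L)) L a)).range) := borel _
  haveI : BorelSpace (↥(UnitaryGroup.adelic (↥(maximalRealSubfield L)) L (IsCMField.complexConj L) 1 (JW (↥(maximalRealSubfield L)) L a)) ⧸ (UnitaryGroup.toAdelic (↥(maximalRealSubfield L)) L (IsCMField.complexConj L) 1 (JW (↥(maximalRealSubfield L)) L a)).range) := ⟨rfl⟩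
  haveI hN := normal_range_toAdelic_JW L a
  obtain ⟨hρ, μW, hfin, hinv, f, Φ, hθ, hmem, hne⟩ := h
  have hpr : P.space.toSubmodule.starProjection (MemLp.toLp _ hθ) ≠ 0 := by
    rwa [Submodule.starProjection_eq_self_iff.mpr hmem]
  obtain ⟨χ, hχ⟩ := exists_charCM_of_apply_toLp_lineThetaLift_ne_zero L N H e₁ dV hdV hdV0 ιA hιA μ hμ a hρ μW Φ f μA
    (P.space.toSubmodule.starProjection) hpr
  exact ⟨hρ, μW, hfin, hinv, Φ, χ, _, hχ⟩

end Seam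

end Summit.HodgeConjecture.HodgeConjecture.Cruxes.HLiu418.F0LD2ThetaSeamCharacter

end
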